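import Summits.BirchSwinnertonDyer.BirchSwinnertonDyer.Theorems.SignedLowerHalvesKobayashiMainConjectureSmallImageTameFrobenius
import Summits.BirchSwinnertonDyer.Rank1Residual.GaloisImage.NonsplitDihedralFieldImaginary
import HarnessLib

/-!
# Route `SignedLowerHalves`, crux `KobayashiMainConjectureSmallImage` (item stmt-BirchSwinnertonDyer-19002):
# on the crux's ENTIRE domain the dihedral field of `ρ̄_{E,p}` is an imaginary quadratic field in
# which `p` is INERT — the CM shadow `(K, p inert)` of the L4-CM / L4-JLK road as ONE class-wide
# kernel theorem (cell `bsd-ssimc`, seat `bsd-ssimc-k3-c4` gen 11, object «L4-INERT», part 2 of 2;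
# THEOREMS ONLY — no definition, no named fact, nothing booked; helper file `--supports` item 4)

PARTITION (cell bsd-ssimc): X7 (A7) × item 4's ENTIRE small-image domain (odd good supersingular
`p`, `ClassX7 W p`, `¬ Surj W p` = the non-CM `X_ns⁺(p)` locus; every `p`, both ranks) —
types-the-object-of; closes none; crux 4 OPEN (no engine); 0 census moves. BSD is not proved by
any of this.

## What this file proves

Setting: `E = W/ℚ` globally minimal, `p ≠ 2`, `GoodSS W p` (good supersingular), `ρ̄_{E,p}` not onto;
a frame `(e, Φ)` of `E[p]`; `kˣ = Serre1972.unitGroup k` a non-split Cartan subgroup of `GL₂(𝔽_p)`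
normalised by the image `G = Φ(ρ̄(Γ_ℚ))`; `U = ρ̄⁻¹(Φ⁻¹(kˣ)) ≤ Γ_ℚ`, the open index-`2` subgroup of the
b2b theorem `exists_imaginary_index_two_subgroup_of_goodSS_of_not_surj` (Serre 1972 §4.2 c), §5.2
(iv)): its fixed field `M` is an IMAGINARY quadratic field, unramified at `p` and at every good or
multiplicative place, with `ρ̄_{E,p} ≅ Ind_M^ℚ χ̄`.

* `smallImage_frob_not_mem_comap_unitGroup` — **every arithmetic Frobenius `σ` at every prime
  `𝔔 ∣ p` of `\bar ℤ` lies OUTSIDE `U`** (tree idiom `∀ 𝔔 ∈ v.primesAbove, ∀ σ, IsArithFrobAt (𝓞 ℚ) σ 𝔔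
  → σ ∉ U`): by Prop. 14 the inertia Cartan subgroup at `𝔔` IS `kˣ`
  (`exists_unitGroup_eq_inertia_image_of_goodSS`, `prop14_unitGroup`), and part 1's
  `smallImage_frob_not_mem_unitGroup` (Frobenius conjugation = `p`-th power on the inertia image,
  `p² - 1 ∤ p - 1`) puts `Φ(ρ̄ σ)` outside it.  With `I_𝔔 ≤ U` this says: **`p` is INERT in `M`**.
* `smallImage_exists_imaginary_inert_index_two_subgroup_of_goodSS_of_not_surj` — the b2b datum
  (field `k` of degree `2`, `G ≤ N(kˣ)`, `U` open of index `2`, `I_𝔔 ≤ U` above `p` and above every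
  good / multiplicative place, no complex conjugation in `U`) WITH the inertness clause added.
* `smallImage_exists_frame_shadow_inert` — **the crux-domain statement** (`p ≠ 2`, `ClassX7 W p`,
  `¬ Surj W p`; frames exist, `exists_frame_galoisRepTorsion_rat`): there are a frame and a non-split
  Cartan `kˣ` such that `M = Fix(U)` is imaginary quadratic, unramified at `p` and outside the
  additive primes of `E`, and `p` is inert in `M`.  So EVERY item-4 pair `(E, p)` carries the CM
  shadow `(K = M, p inert in K)`: `ρ̄_{E,p} ≅ Ind_K χ̄` with `χ̄|_{I_p}` the level-`2` fundamental
  character — the shape of the mod-`p` representation of a weight-`2` CM newform `g = θ(ψ)` of `K`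
  with `a_p(g) = 0`.

Why (seam S6 of k3c4-MEMO-9 §2, planner D30-11 (2)): the congruence road L4-CM / L4-JLK transfers
Kobayashi's signed main conjecture to `E` from a CM newform partner `g` over `K`; every signed-theory
input on the partner side — Lei 2011 assumption (1) `a_p(g) = 0`, Hatley–Lei 2019 (tor)/(BLZ),
Kobayashi's `±` conditions for `A_g[𝔓^∞]` — holds BECAUSE `p` is inert in `K`.  Before this file
the inertness was a per-pair NUMERICAL check (kit j272679, column `K`, on the 21 newform-partnered
window pairs; gen 10's self-twist records p512219 / p512877 pin `K` per pair, not the splitting of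
`p`) and «standard CFT; to be cited when typed»; it is now a kernel theorem on the whole `X_ns⁺(p)`
locus at every odd `p` (infinitely many non-CM pairs at `p ∈ {3, 5, 7, 11}`).

What is NOT here: which `K` (per pair: gen 10's self-twist certificates); the conductor of `χ̄`
(additive primes only — the unramified clause above); the CM newform `g` itself, its existence with
trivial nebentypus, or anything on the Iwasawa side (wants W-TY-NF / W-ENG-NF / W-CERT-CONG of
MEMO-9 §6); `p = 2`; nothing booked; crux 4 and item 4 stay OPEN.

References: [Serre1972] §1.11 Prop. 12, §2.2 Prop. 14, §4.2 c), §5.2 (iv); [SerreKyoto1977] 6.5–6.6;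
[Kobayashi2003] Conjecture (p. 2); [Lei2011] §3 assumption (1); [HatleyLei2019] Thm. 4.6.
-/

set_option autoImplicit false
set_option linter.dupNamespace false

noncomputable section

open scoped Classical NumberField Pointwise
open IsDedekindDomain Field Matrix NumberField WeierstrassCurve Literature.NumberTheory.EllipticCurves
  Literature.NumberTheory.GaloisRepresentations Rat.HeightOneSpectrum
  Literature.NumberTheory.EllipticCurves.Rank1Residual Summit.BirchSwinnertonDyer.Rank1Residual

namespace Summit.BirchSwinnertonDyer.BirchSwinnertonDyer.Theorems

/-- **`p` is inert in the dihedral field (frame form on `U = ρ̄⁻¹(Φ⁻¹(kˣ))`).**  Let `E = W/ℚ` be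
globally minimal with good supersingular reduction at `p ≠ 2`, `Φ` a frame of `E[p]`, and
`k ⊆ M₂(𝔽_p)` a field of degree `2` whose unit group `kˣ` is normalised by the image `Φ(ρ̄(Γ_ℚ))`.
Then for every place `v ∣ p` of `ℚ`, every prime `𝔔` of `\bar ℤ` above `v` and every arithmetic
Frobenius `σ` at `𝔔`: `σ ∉ U`.  (The inertia image at `𝔔` is a non-split Cartan subgroup inside
`N(kˣ)`, hence `= kˣ` by Prop. 14; and `Φ(ρ̄ σ) ∉ kˣ` by part 1.)  Supersedes the per-pair check
«`p` inert in `K`» of kit j272679 (column `K`, 21 pairs). [cite: Serre1972, §2.2 Prop. 14 and §4.2 c)] -/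
theorem smallImage_frob_not_mem_comap_unitGroup
    (W : WeierstrassCurve ℚ) [W.IsElliptic] [W.IsGloballyMinimal] (p : ℕ) [Fact p.Prime]
    (Φ : Multiplicative (AddAut (geomTorsion W p)) ≃* GL (Fin 2) (ZMod p))
    (hp2 : p ≠ 2) (hss : GoodSS W p)
    {k : Subalgebra (ZMod p) (Matrix (Fin 2) (Fin 2) (ZMod p))} (hk : IsField k)
    (h2 : Module.finrank (ZMod p) k = 2)
    (hGN : (galoisRepTorsion W p).range.map Φ.toMonoidHom ≤
      Subgroup.normalizer (Serre1972.unitGroup k : Set (GL (Fin 2) (ZMod p))))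
    {v : HeightOneSpectrum (𝓞 ℚ)} (hpv : (p : 𝓞 ℚ) ∈ v.asIdeal)
    {𝔔 : Ideal (absIntegers (𝓞 ℚ) ℚ)} (h𝔔 : 𝔔 ∈ v.primesAbove)
    {σ : absoluteGaloisGroup ℚ} (hσ : IsArithFrobAt (𝓞 ℚ) σ 𝔔) :
    σ ∉ ((Serre1972.unitGroup k).comap Φ.toMonoidHom).comap (galoisRepTorsion W p) := by
  have hpP : p.Prime := Fact.out
  have hp3 : 3 ≤ p := by have := hpP.two_le; omega
  have hv' : (primesEquiv v : ℕ) = p := primesEquiv_eq_of_natCast_mem hpP hpv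
  obtain ⟨k', hk', h2', hk'I⟩ :=
    GaloisImage.exists_unitGroup_eq_inertia_image_of_goodSS W p Φ hp2 hss hv' h𝔔
  have hC : Serre1972.unitGroup k ∈ Serre1972.cartanSubgroups (ZMod p) :=
    Serre1972.unitGroup_mem_cartanSubgroups hk h2
  have hHle : ((𝔔.inertia (absoluteGaloisGroup ℚ)).map (galoisRepTorsion W p)).map Φ.toMonoidHom ≤
      (galoisRepTorsion W p).range.map Φ.toMonoidHom :=
    Subgroup.map_mono (fun x ⟨τ, _, hτ⟩ ↦ ⟨τ, hτ⟩)
  have hk'N : Serre1972.unitGroup k' ≤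
      Subgroup.normalizer (Serre1972.unitGroup k : Set (GL (Fin 2) (ZMod p))) := by
    rw [← hk'I]
    exact hHle.trans hGN
  have hkk : Serre1972.unitGroup k' = Serre1972.unitGroup k := Serre1972.prop14_unitGroup hC hp3 hk' h2' hk'N
  rw [mem_comap_cartan_iff]
  exact smallImage_frob_not_mem_unitGroup W p Φ hp2 hss hv' h𝔔 hσ hk (hkk ▸ hk'I.le)

/-- **The dihedral datum of a non-surjective good supersingular prime, with inertness.**  At a good
supersingular `p ≠ 2` (`W` globally minimal) with `ρ̄_{E,p}` not onto, for a frame `(e, Φ)` of `E[p]`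
there is a field `k ⊆ M₂(𝔽_p)` of degree `2` with: `Φ(ρ̄(Γ_ℚ)) ≤ N(kˣ)`; `U = ρ̄⁻¹(Φ⁻¹(kˣ))` open of
index `2`; `I_𝔔 ≤ U` for every `𝔔` above `p` and above every good or multiplicative place
(`M = Fix U` is unramified there); no complex conjugation in `U` (`M` is IMAGINARY quadratic) — all
from the b2b theorem `exists_imaginary_index_two_subgroup_of_goodSS_of_not_surj` — AND every
arithmetic Frobenius at every prime above `p` lies outside `U` (**`p` is INERT in `M`**,
`smallImage_frob_not_mem_comap_unitGroup`).  The structural reason the CM newform partner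
`g = θ(ψ)` over `K = M` of the L4-CM / L4-JLK road has `a_p(g) = 0` (Lei 2011 assumption (1),
Hatley–Lei 2019 (tor)). [cite: Serre1972, §1.11 Prop. 12, §2.2 Prop. 14, §4.2 c) and §5.2 (iv)] -/
theorem smallImage_exists_imaginary_inert_index_two_subgroup_of_goodSS_of_not_surj
    (W : WeierstrassCurve ℚ) [W.IsElliptic] [W.IsGloballyMinimal] (p : ℕ) [Fact p.Prime]
    (Φ : Multiplicative (AddAut (geomTorsion W p)) ≃* GL (Fin 2) (ZMod p))
    (e : geomTorsion W p ≃+ (Fin 2 → ZMod p))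
    (he : ∀ (g : Multiplicative (AddAut (geomTorsion W p))) (x : geomTorsion W p),
      e (Multiplicative.toAdd g x) =
        ((Φ g : GL (Fin 2) (ZMod p)) : Matrix (Fin 2) (Fin 2) (ZMod p)) *ᵥ e x)
    (hp2 : p ≠ 2) (hss : GoodSS W p) (hns : ¬ Surj W p) :
    ∃ k : Subalgebra (ZMod p) (Matrix (Fin 2) (Fin 2) (ZMod p)), IsField k ∧
      Module.finrank (ZMod p) k = 2 ∧
      (galoisRepTorsion W p).range.map Φ.toMonoidHom ≤
          Subgroup.normalizer (Serre1972.unitGroup k : Set (GL (Fin 2) (ZMod p))) ∧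
      IsOpen ((((Serre1972.unitGroup k).comap Φ.toMonoidHom).comap (galoisRepTorsion W p) :
          Subgroup (absoluteGaloisGroup ℚ)) : Set (absoluteGaloisGroup ℚ)) ∧
      (((Serre1972.unitGroup k).comap Φ.toMonoidHom).comap (galoisRepTorsion W p)).index = 2 ∧
      (∀ v : HeightOneSpectrum (𝓞 ℚ),
        ((p : 𝓞 ℚ) ∈ v.asIdeal ∨ W.HasGoodReductionAt v ∨ W.HasMultiplicativeReductionAt v) →
        ∀ 𝔔 ∈ v.primesAbove,
          𝔔.inertia (absoluteGaloisGroup ℚ) ≤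
            ((Serre1972.unitGroup k).comap Φ.toMonoidHom).comap (galoisRepTorsion W p)) ∧
      (∀ c : absoluteGaloisGroup ℚ, IsComplexConjugation (Rat.castHom ℝ) c →
        c ∉ ((Serre1972.unitGroup k).comap Φ.toMonoidHom).comap (galoisRepTorsion W p)) ∧
      (∀ v : HeightOneSpectrum (𝓞 ℚ), (p : 𝓞 ℚ) ∈ v.asIdeal → ∀ 𝔔 ∈ v.primesAbove,
        ∀ σ : absoluteGaloisGroup ℚ, IsArithFrobAt (𝓞 ℚ) σ 𝔔 →
          σ ∉ ((Serre1972.unitGroup k).comap Φ.toMonoidHom).comap (galoisRepTorsion W p)) := by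
  obtain ⟨k, hk, h2, hGN, hopen, hidx, hin, himag⟩ :=
    GaloisImage.exists_imaginary_index_two_subgroup_of_goodSS_of_not_surj W p Φ e he hp2 hss hns
  exact ⟨k, hk, h2, hGN, hopen, hidx, hin, himag, fun v hpv 𝔔 h𝔔 σ hσ ↦
    smallImage_frob_not_mem_comap_unitGroup W p Φ hp2 hss hk h2 hGN hpv h𝔔 hσ⟩

/-- **«L4-INERT» on the crux's domain, frame-free.**  For every X7 pair at an odd prime with
`ρ̄_{E,p}` NOT surjective (the domain of `Theses.SignedLowerHalves.KobayashiMainConjectureSmallImage`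
= the non-CM `ℚ`-points of `X_ns⁺(p)`; `¬CM` and `a_p = 0` are not needed) there are a frame
`(e, Φ)` of `E[p]` and a field `k ⊆ M₂(𝔽_p)` of degree `2` such that the image normalises `kˣ`,
`U = ρ̄⁻¹(Φ⁻¹(kˣ))` has index `2`, contains the inertia above `p` and above every good /
multiplicative place, contains no complex conjugation, and contains NO arithmetic Frobenius above
`p`: the CM shadow `(K, p)` of EVERY item-4 pair is an imaginary quadratic field `K`, unramified
outside the additive primes of `E`, with `p` INERT in `K` and `ρ̄_{E,p}` induced from `K`.  Class-wide,
every `p`; replaces seam S6 of k3c4-MEMO-9 §2 and the per-pair numerics of kit j272679.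
[cite: Serre1972, §1.11 Prop. 12, §2.2 Prop. 14, §4.2 c) and §5.2 (iv)] -/
theorem smallImage_exists_frame_shadow_inert
    (W : WeierstrassCurve ℚ) [W.IsElliptic] [W.IsGloballyMinimal] (p : ℕ) [Fact p.Prime]
    (hp : p ≠ 2) (hX : ClassX7 W p) (hs : ¬ Surj W p) :
    ∃ (e : geomTorsion W p ≃+ (Fin 2 → ZMod p))
      (Φ : Multiplicative (AddAut (geomTorsion W p)) ≃* GL (Fin 2) (ZMod p)),
      (∀ (g : Multiplicative (AddAut (geomTorsion W p))) (x : geomTorsion W p),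
        e (Multiplicative.toAdd g x) =
          ((Φ g : GL (Fin 2) (ZMod p)) : Matrix (Fin 2) (Fin 2) (ZMod p)) *ᵥ e x) ∧
      ∃ k : Subalgebra (ZMod p) (Matrix (Fin 2) (Fin 2) (ZMod p)), IsField k ∧
        Module.finrank (ZMod p) k = 2 ∧
        (galoisRepTorsion W p).range.map Φ.toMonoidHom ≤
            Subgroup.normalizer (Serre1972.unitGroup k : Set (GL (Fin 2) (ZMod p))) ∧
        (((Serre1972.unitGroup k).comap Φ.toMonoidHom).comap (galoisRepTorsion W p)).index = 2 ∧
        (∀ v : HeightOneSpectrum (𝓞 ℚ),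
          ((p : 𝓞 ℚ) ∈ v.asIdeal ∨ W.HasGoodReductionAt v ∨ W.HasMultiplicativeReductionAt v) →
          ∀ 𝔔 ∈ v.primesAbove,
            𝔔.inertia (absoluteGaloisGroup ℚ) ≤
              ((Serre1972.unitGroup k).comap Φ.toMonoidHom).comap (galoisRepTorsion W p)) ∧
        (∀ c : absoluteGaloisGroup ℚ, IsComplexConjugation (Rat.castHom ℝ) c →
          c ∉ ((Serre1972.unitGroup k).comap Φ.toMonoidHom).comap (galoisRepTorsion W p)) ∧
        (∀ v : HeightOneSpectrum (𝓞 ℚ), (p : 𝓞 ℚ) ∈ v.asIdeal → ∀ 𝔔 ∈ v.primesAbove,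
          ∀ σ : absoluteGaloisGroup ℚ, IsArithFrobAt (𝓞 ℚ) σ 𝔔 →
            σ ∉ ((Serre1972.unitGroup k).comap Φ.toMonoidHom).comap (galoisRepTorsion W p)) := by
  obtain ⟨e, Φ, he, -⟩ := exists_frame_galoisRepTorsion_rat W p
  obtain ⟨k, hk, h2, hGN, -, hidx, hin, himag, hinert⟩ :=
    smallImage_exists_imaginary_inert_index_two_subgroup_of_goodSS_of_not_surj W p Φ e he hp hX.1 hs
  exact ⟨e, Φ, he, k, hk, h2, hGN, hidx, hin, himag, hinert⟩

end Summit.BirchSwinnertonDyer.BirchSwinnertonDyer.Theorems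

end
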